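import Summits.BirchSwinnertonDyer.BirchSwinnertonDyer.Theorems.PrintCFramBottomClassIndexLawFiveLeGenusInternalShaInput
import Summits.BirchSwinnertonDyer.BirchSwinnertonDyer.Theorems.PrintCFramBottomClassIndexLawFiveLeGenusInternalShaTwist
import HarnessLib

/-!
# Crux `PrintCFram.BottomClassIndexLawFiveLe` (stmt-BirchSwinnertonDyer-20372), line `eisenstein-resource-bdp-line` (registry v26),
# genus-internal branch of `stub_seedOffExc` — THE IDENTITY-ROAD END STATE AT `(X₀(49), 7)` WITH ITS LAST BINDER DISCHARGED:
# `BSD(W,7)` for every rank-one twist `W ≅ X₀(49)^{(d_K)}` of a `7`-REGULAR Heegner field, Hsieh/LZZ/toric-FREE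
# (cell `bsd-print-cfram`, width seat `bsd-line-cfram-p1-w4` g19; THEOREMS ONLY, `--supports` 20372; BSD is not proved by any of this)

HONEST FRAMING. THEOREMS ONLY (0 defs / 0 facts / 0 sorry); every statement is CONDITIONAL on named published facts taken as hypotheses
(Kriz–Li 2019 Thm. 1.20, Gross–Zagier I.(6.3) + Kolyvagin at `(N, X₀(49), K)`, GZK, modularity, Gross–Zagier I.(7.3), Cassels–Tate, and the
rank-zero inputs `BSDp cm7 7` (Burungale–Flach 2024 Cor. 2) and `cm7.analyticRank = 0`; Cassels' isogeny invariance for §2); nothing about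
BSD is proved unconditionally; no registered stub is closed; no summit statement is proved by this seat; the crux stays OPEN and is NOT
claimed false. This is the 30-line COMPOSITION handed to this seat by w3 g16 (HOME STATUS 2026-08-29T07:05:14Z): w3 g16's end state
`GenusInternal.bsdp_twist_cm7_of_regular_of_sha_twist` (p704704, GI-4) with its binder `h0W : Ш(W)[7] = 0` DISCHARGED by this seat's
`GenusInternal.sha_noSevenTorsion_of_regular_of_smul_eq_twist_cm7_heegner` (p705226, GI-5).

* §1 **`bsdp_twist_cm7_of_regular_identityRoad`** (`χ`-currency with the values bridge to `ε_K`) and **`…_kronecker_identityRoad`**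
  (`χ := ε_K`): binder list = w3 g16's minus `h0W`. FACT SET of this road: {KL Thm 1.20, GZ I.6.3 + Kolyvagin at `(N, cm7, K)`, GZK,
  modularity, GZ I.7.3, Cassels–Tate, `BSDp cm7 7`, `cm7.analyticRank = 0`, a level-`N` parametrisation datum with `7 ∤ c`} — NO Hsieh
  Thm A, NO Liu–Zhang–Zhang, NO toric bundle, NO `d_K < −4`, any parity of `d_K`: a second, independent provider of the genus-internal
  end at `p = 7` next to w7 g7's Manin-free `bsdp_twist_cm7_of_regular_kronecker` (p703735, fact set prints4 ∧ KL).
* §2 **`bsdp_of_isIsogenous_twist_cm7_of_regular_kronecker_identityRoad`**: the isogeny-class form (any globally minimal `W'` of analytic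
  rank one `ℚ`-isogenous to `W`), by Cassels' invariance `X2.bsdp_of_isIsogenous_of_bsdp` (`bsdRHS_eq_of_isIsogenous` as a binder).

beyond-print theorem: NO (composition of landed sockets). References: Kriz–Li 2019 Thm. 1.20; Gross–Zagier 1986 I.(6.3), I.(7.3);
Kolyvagin 1990; Burungale–Flach 2024 Cor. 2; Cassels 1962/1965; Milne ADT I.7.3; crux workfiles `Lines/eisenstein-resource-bdp-line-w3g16-notes.md` §3–§3b.
-/

set_option autoImplicit false
-- `…BirchSwinnertonDyer.BirchSwinnertonDyer.Theorems…` is the problem's mandated namespace (D-0017).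
set_option linter.dupNamespace false

noncomputable section

open scoped Classical

open WeierstrassCurve NumberField DirichletCharacter
  Literature.NumberTheory.EllipticCurves
  Literature.NumberTheory.EllipticCurves.ModularForms
  Literature.NumberTheory.EllipticCurves.KrizLi2019
  Literature.NumberTheory.LFunctions
  Literature.NumberTheory.EllipticCurves.Rank1Residual
  Literature.NumberTheory.EllipticCurves.Rank1Residual.Typed
  Summit.BirchSwinnertonDyer.Rank1Residual
  Summit.BirchSwinnertonDyer.Rank1Residual.X12.O11
  Summit.BirchSwinnertonDyer.BirchSwinnertonDyer.Theorems.GoldfeldGoodTwists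
  Summit.BirchSwinnertonDyer.BirchSwinnertonDyer.Theorems.PrintCFram

namespace Summit.BirchSwinnertonDyer.BirchSwinnertonDyer.Theorems.PrintCFram.GenusInternal

/-! ## §1 The identity-road end state, `h0W` discharged -/

/-- **IDENTITY ROAD, COMPLETE: `BSD(W,7)` for the rank-one twist `W ≅ X₀(49)^{(d_K)}` of a `7`-REGULAR Heegner field `K` of `X₀(49)`
(`χ`-currency).** Data: `K` imaginary quadratic with the Heegner hypothesis for `N = N_{X₀(49)}`, its Kronecker character `ε_K`, a
primitive `χ` mod `m ⊥ 7` agreeing with `ε_K` at all primes `ℓ ∤ N₀` and REGULAR (`7 ∤ B_{5,χ}/5`); a level-`N` parametrisation datum `Dt`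
with `7 ∤ c(Dt)`, a Heegner datum `H`, `ι : K → ℂ`, `ιp : K → ℚ₇`, the Heegner point `P`; ANY globally minimal `W` with
`C • W = X₀(49)^{(d_K)}` and `ord_{s=1} L(W,s) = 1`. Facts by name: Kriz–Li Thm 1.20, Gross–Zagier/Kolyvagin at `(N, cm7, K)`, GZK,
modularity, Gross–Zagier I.(7.3), Cassels–Tate, `BSDp cm7 7`, `cm7.analyticRank = 0`. Conclusion: **`BSDp W 7`**. Proof: w3 g16's
`bsdp_twist_cm7_of_regular_of_sha_twist` with `h0W := sha_noSevenTorsion_of_regular_of_smul_eq_twist_cm7_heegner` (this seat, GI-5: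
the twist is a class member whose class factor is the unit `K`-factor `B_{1,(ω⁴ε_K)~} ≡ B_{5,χ}/5`, so `#Sel₇(W/ℚ) ≤ 7` and Cassels–Tate).
No Hsieh / Liu–Zhang–Zhang / toric input, no `d_K < −4`, any parity of `d_K`. CONDITIONAL on the named facts; closes no stub.
[cite: KrizLi2019, Thm. 1.20 (pp. 7–8), Rem. 1.21 (p. 8), §7.1 (p. 43)] [cite: GrossZagier1986, Thm. I.(6.3) and (7.3)]
[cite: BurungaleFlach2024, Thm. 1.1 and Cor. 2] [cite: Cassels1962ArithmeticIV] [cite: BhargavaSkinner2014, proof of Lemma 16] -/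
theorem bsdp_twist_cm7_of_regular_identityRoad (h120 : thm120_padicLogHeegner_unit_of_bernoulli)
    (hCT : exists_casselsTate_pairing (K := ℚ)) (hGZK : rank_eq_analyticRank_of_analyticRank_le_one)
    (hmod : hasEntireLFunction_rat) (hGZ73 : GrossZagier1986_thm_I_7_3)
    (hB : BSDp cm7 7) (hr0 : cm7.analyticRank = 0)
    {N : ℕ} [NeZero N] (hN : cm7.conductorNorm ℤ = N)
    (K : Type) [Field K] [NumberField K] (hK : IsImaginaryQuadratic K) (hH : SatisfiesHeegnerHypothesis N K)
    (hGZ : gross_zagier N cm7 K) (hKo : kolyvagin N cm7 K)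
    (εK : DirichletCharacter ℚ_[7] (NumberField.discr K).natAbs) (hεK : IsKroneckerCharacterOf K εK)
    {m : ℕ} [NeZero m] (χ : DirichletCharacter ℚ_[7] m) (hχ : χ.IsPrimitive) (hm7 : m.Coprime 7)
    {N₀ : ℕ} (hN₀ : N₀ ≠ 0)
    (hχε : ∀ ℓ : ℕ, ℓ.Prime → ¬ ℓ ∣ N₀ → χ (ℓ : ZMod m) = εK (ℓ : ZMod (NumberField.discr K).natAbs))
    (hreg : ¬ ‖(5 : ℚ_[7])⁻¹ * generalizedBernoulli 5 χ‖ ≤ (7 : ℝ)⁻¹)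
    (Dt : ModularParametrizationData cm7 N) (H : HeegnerDatum N (NumberField.discr K)) (ι : K →+* ℂ) (ιp : K →+* ℚ_[7])
    (P : (cm7.baseChange K).toAffine.Point)
    (hP : WeierstrassCurve.Affine.Point.map ι.toRatAlgHom P = heegnerPointComplex Dt H)
    (hc : ¬ (7 : ℤ) ∣ Dt.c)
    (W : WeierstrassCurve ℚ) [W.IsElliptic] [W.IsGloballyMinimal]
    (hW : ∃ C : VariableChange ℚ, C • W = cm7.quadraticTwist (NumberField.discr K : ℚ)) (hrW : W.analyticRank = 1) :
    BSDp W 7 :=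
  bsdp_twist_cm7_of_regular_of_sha_twist h120 hCT hGZK hmod hGZ73 hB hr0 hN K hK hH hGZ hKo εK hεK χ hχ hm7 hN₀ hχε hreg
    Dt H ι ιp P hP hc W hW hrW
    (sha_noSevenTorsion_of_regular_of_smul_eq_twist_cm7_heegner hCT hGZK hN K hK hH εK hεK χ hχ hm7 hN₀ hχε hreg W hW hrW)

/-- **IDENTITY ROAD, COMPLETE, in KRONECKER currency (`χ := ε_K`, regularity `7 ∤ B_{5,ε_K}/5`):** `BSDp W 7` for every globally minimal
`W` with `C • W = X₀(49)^{(d_K)}` and `W.analyticRank = 1`, `K` a `7`-regular imaginary quadratic Heegner field for `N = N_{X₀(49)}`, from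
the identity road's fact set (Kriz–Li Thm 1.20, GZ/Kolyvagin at `(N, cm7, K)`, GZK, modularity, GZ I.(7.3), Cassels–Tate, `BSDp cm7 7`,
`cm7.analyticRank = 0`, a level-`N` datum with `7 ∤ c`). CONDITIONAL; closes no stub.
[cite: KrizLi2019, Thm. 1.20 (pp. 7–8) and Rem. 1.21 (p. 8)] [cite: GrossZagier1986, Thm. I.(6.3) and (7.3)] [cite: BurungaleFlach2024, Cor. 2]
[cite: Cassels1962ArithmeticIV] -/
theorem bsdp_twist_cm7_of_regular_kronecker_identityRoad (h120 : thm120_padicLogHeegner_unit_of_bernoulli)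
    (hCT : exists_casselsTate_pairing (K := ℚ)) (hGZK : rank_eq_analyticRank_of_analyticRank_le_one)
    (hmod : hasEntireLFunction_rat) (hGZ73 : GrossZagier1986_thm_I_7_3)
    (hB : BSDp cm7 7) (hr0 : cm7.analyticRank = 0)
    {N : ℕ} [NeZero N] (hN : cm7.conductorNorm ℤ = N)
    (K : Type) [Field K] [NumberField K] (hK : IsImaginaryQuadratic K) (hH : SatisfiesHeegnerHypothesis N K)
    (hGZ : gross_zagier N cm7 K) (hKo : kolyvagin N cm7 K)
    (εK : DirichletCharacter ℚ_[7] (NumberField.discr K).natAbs) (hεK : IsKroneckerCharacterOf K εK)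
    (hreg : ¬ ‖(5 : ℚ_[7])⁻¹ * generalizedBernoulli 5 εK‖ ≤ (7 : ℝ)⁻¹)
    (Dt : ModularParametrizationData cm7 N) (H : HeegnerDatum N (NumberField.discr K)) (ι : K →+* ℂ) (ιp : K →+* ℚ_[7])
    (P : (cm7.baseChange K).toAffine.Point)
    (hP : WeierstrassCurve.Affine.Point.map ι.toRatAlgHom P = heegnerPointComplex Dt H)
    (hc : ¬ (7 : ℤ) ∣ Dt.c)
    (W : WeierstrassCurve ℚ) [W.IsElliptic] [W.IsGloballyMinimal]
    (hW : ∃ C : VariableChange ℚ, C • W = cm7.quadraticTwist (NumberField.discr K : ℚ)) (hrW : W.analyticRank = 1) :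
    BSDp W 7 :=
  bsdp_twist_cm7_of_regular_kronecker_of_sha_twist h120 hCT hGZK hmod hGZ73 hB hr0 hN K hK hH hGZ hKo εK hεK hreg
    Dt H ι ιp P hP hc W hW hrW
    (sha_noSevenTorsion_of_regular_kronecker_of_smul_eq_twist_cm7_heegner hCT hGZK hN K hK hH εK hεK hreg W hW hrW)

/-! ## §2 Along the `ℚ`-isogeny class (Cassels) -/

/-- **Isogeny-class form of the identity road:** for the data of `bsdp_twist_cm7_of_regular_kronecker_identityRoad` and any globally minimal
`W'` that is `ℚ`-ISOGENOUS to the rank-one model `W` of `X₀(49)^{(d_K)}`: **`BSDp W' 7`**, by Cassels' invariance of the BSD quotient along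
a `ℚ`-isogeny in analytic rank `≤ 1` (`X2.bsdp_of_isIsogenous_of_bsdp`; `Ш` finite by GZK, leading coefficient `≠ 0` by modularity). So the
conclusion is a statement about the ISOGENY CLASS of the class member `A(7)^{(e*)}` — the currency of the LEAD's routing. CONDITIONAL on the
named facts (now including `bsdRHS_eq_of_isIsogenous`); closes no stub; BSD is not proved by any of this.
[cite: KrizLi2019, Thm. 1.20 (pp. 7–8) and Rem. 1.21 (p. 8)] [cite: Cassels1965ArithmeticVIII] [cite: MilneADT2006, Thm. I.7.3]
[cite: BurungaleFlach2024, Cor. 2] -/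
theorem bsdp_of_isIsogenous_twist_cm7_of_regular_kronecker_identityRoad (h120 : thm120_padicLogHeegner_unit_of_bernoulli)
    (hCas : bsdRHS_eq_of_isIsogenous)
    (hCT : exists_casselsTate_pairing (K := ℚ)) (hGZK : rank_eq_analyticRank_of_analyticRank_le_one)
    (hmod : hasEntireLFunction_rat) (hGZ73 : GrossZagier1986_thm_I_7_3)
    (hB : BSDp cm7 7) (hr0 : cm7.analyticRank = 0)
    {N : ℕ} [NeZero N] (hN : cm7.conductorNorm ℤ = N)
    (K : Type) [Field K] [NumberField K] (hK : IsImaginaryQuadratic K) (hH : SatisfiesHeegnerHypothesis N K)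
    (hGZ : gross_zagier N cm7 K) (hKo : kolyvagin N cm7 K)
    (εK : DirichletCharacter ℚ_[7] (NumberField.discr K).natAbs) (hεK : IsKroneckerCharacterOf K εK)
    (hreg : ¬ ‖(5 : ℚ_[7])⁻¹ * generalizedBernoulli 5 εK‖ ≤ (7 : ℝ)⁻¹)
    (Dt : ModularParametrizationData cm7 N) (H : HeegnerDatum N (NumberField.discr K)) (ι : K →+* ℂ) (ιp : K →+* ℚ_[7])
    (P : (cm7.baseChange K).toAffine.Point)
    (hP : WeierstrassCurve.Affine.Point.map ι.toRatAlgHom P = heegnerPointComplex Dt H)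
    (hc : ¬ (7 : ℤ) ∣ Dt.c)
    (W : WeierstrassCurve ℚ) [W.IsElliptic] [W.IsGloballyMinimal]
    (hW : ∃ C : VariableChange ℚ, C • W = cm7.quadraticTwist (NumberField.discr K : ℚ)) (hrW : W.analyticRank = 1)
    (W' : WeierstrassCurve ℚ) [W'.IsElliptic] [W'.IsGloballyMinimal] (hiso : IsIsogenous W W') :
    BSDp W' 7 := by
  haveI h7 : Fact (Nat.Prime 7) := ⟨by norm_num⟩
  have h₁ : BSDp W 7 := bsdp_twist_cm7_of_regular_kronecker_identityRoad h120 hCT hGZK hmod hGZ73 hB hr0 hN K hK hH hGZ hKo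
    εK hεK hreg Dt H ι ιp P hP hc W hW hrW
  exact X2.bsdp_of_isIsogenous_of_bsdp hCas hGZK hmod W W' hiso 7 hrW.le h₁

end Summit.BirchSwinnertonDyer.BirchSwinnertonDyer.Theorems.PrintCFram.GenusInternal

end
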